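import Summits.KontsevichZagierPeriods.KontsevichZagierPeriods.Theses.HurwitzMicroSectors
import Summits.KontsevichZagierPeriods.KontsevichZagierPeriods.Theorems.HurwitzMicroSectorsNormalFormPrincipleIslandKernel
import Summits.KontsevichZagierPeriods.KontsevichZagierPeriods.Theorems.HurwitzMicroSectorsNormalFormPrinciplePiBoxTransfer
import Summits.KontsevichZagierPeriods.KontsevichZagierPeriods.Theorems.MzvKernelInKZ.Negative.ScalingDivision
import Literature.NumberTheory.Transcendental.KZKernelConjectureForms
import Literature.NumberTheory.Transcendental.KZVolumeConjectureProofs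

/-!
# `SectorIsland` — F3 witness (G4 fwd-ladder, crux `NormalFormPrinciple`, stmt-KontsevichZagierPeriods-3869)

The rung family `SectorIsland E` instantiated at the FLOOR `E = 1` is the landed product island of
lead c9 (`island_mem_relations_of_eval_eq_zero`): `example : SectorIsland 1` below, no `sorry`.
Also recorded: the on-path implication `KontsevichZagierPeriods → SectorIsland E`.
Standalone copy of the definitions of `Lines/SectorLadder.lean` (same namespace; the two files are
never imported together). References: Kontsevich–Zagier 2001 §1.2; Viola–Zudilin 2018 Thm 1.
-/

noncomputable section

open MeasureTheory Set
open Literature.NumberTheory.Transcendental Literature.NumberTheory.Transcendental.KZ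
open Summit.KontsevichZagierPeriods.MzvKernelInKZ.Negative (mem_relations_of_nsmul_mem)
open Summit.KontsevichZagierPeriods.HurwitzMicroSectors.NormalFormPrinciple.PiBox (normalFormPrinciple_of_statement)
open Summit.KontsevichZagierPeriods.HurwitzMicroSectors.NormalFormPrinciple.PiBox.Island (island_mem_relations_of_eval_eq_zero)

namespace Summit.KontsevichZagierPeriods.KontsevichZagierPeriods.Cruxes.NormalFormPrinciple.SectorLadder

/-- **Rigidity input at level `q`** (verbatim the hypothesis `hrig` of the product island): the only
`ℚ`-linear relation among `1`, `ℓ = ∫₀¹dt/(q−t)`, `L₂ = ∫_□² dxdy/(q−xy)`, `ℓ²` is the trivial one.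
A theorem for `q ≥ 9` (Viola–Zudilin 2018, Thm 1, with Landen). [cite: ViolaZudilin2018, Thm 1] -/
def Rig (q : ℕ) : Prop :=
  ∀ a b c d : ℚ,
    (a:ℝ) + b * (∫ t in Set.Ioo (0:ℝ) 1, 1 / ((q:ℝ) - t)) +
      c * (∫ x in {x : Fin 2 → ℝ | ∀ i, x i ∈ Set.Ioo (0:ℝ) 1}, 1 / ((q:ℝ) - x 0 * x 1)) +
      d * (∫ t in Set.Ioo (0:ℝ) 1, 1 / ((q:ℝ) - t)) ^ 2 = 0 → a = 0 ∧ b = 0 ∧ c = 0 ∧ d = 0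

/-- **Generators of the weight-2 level-`q` sector** with numerator degree `≤ A`, linear multiplicities
`≤ P` and hyperbolic multiplicity `≤ M`: the classes `[□², x₀^a x₁^b/((q−x₀)^i (q−x₁)^j (q−x₀x₁)^m)]`
on the open unit square. [cite: KontsevichZagier2001, §1.1] -/
def gens (A P M q : ℕ) : Set FormalRep :=
  {y | ∃ (N : IntegralRep 2) (a b i j m : ℕ), a + b ≤ A ∧ i ≤ P ∧ j ≤ P ∧ m ≤ M ∧
      N.domain = {x | ∀ i, x i ∈ Set.Ioo (0:ℝ) 1} ∧
      EqOn N.integrand (fun x => x 0 ^ a * x 1 ^ b /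
        (((q:ℝ) - x 0) ^ i * ((q:ℝ) - x 1) ^ j * ((q:ℝ) - x 0 * x 1) ^ m)) N.domain ∧
      y = of N}

/-- **RUNG `SectorIsland E`**: Conjecture 1 in kernel form, modulo `Rig q`, on the sector truncated at
height `E` (numerators of degree `≤ E − 1`, all three multiplicities `≤ E`), for every level `q ≥ 2`.
`E = 1` is the product island (floor); the ladder is `E = 1, 2, 3, …`. [cite: KontsevichZagier2001, §1.2 Conjecture 1] -/
def SectorIsland (E : ℕ) : Prop :=
  ∀ q : ℕ, 2 ≤ q → Rig q →
    ∀ c ∈ AddSubgroup.closure (gens (E - 1) E E q), eval c = 0 → c ∈ relations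

/-- The rung one parameter above the floor (`θ₁ = 2`), as a constant for the probes. -/
def SectorIslandTwo : Prop := SectorIsland 2

/-- The ladder's limit `Rung∞`. -/
def SectorIslandAll : Prop := ∀ E : ℕ, 1 ≤ E → SectorIsland E

/-- The eight product-island generator sets of lead c9, verbatim (so that `AddSubgroup.closure_mono`
meets `island_mem_relations_of_eval_eq_zero` definitionally). [cite: KontsevichZagier2001, §1.1] -/
def islandGens (q : ℕ) : Set FormalRep :=
  ({y : FormalRep | ∃ N : IntegralRep 2, N.domain = {x | ∀ i, x i ∈ Set.Ioo (0:ℝ) 1} ∧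
      EqOn N.integrand (fun _ => (1:ℝ)) N.domain ∧ y = of N} ∪
   {y : FormalRep | ∃ N : IntegralRep 2, N.domain = {x | ∀ i, x i ∈ Set.Ioo (0:ℝ) 1} ∧
      EqOn N.integrand (fun x => 1 / ((q:ℝ) - x 0)) N.domain ∧ y = of N} ∪
   {y : FormalRep | ∃ N : IntegralRep 2, N.domain = {x | ∀ i, x i ∈ Set.Ioo (0:ℝ) 1} ∧
      EqOn N.integrand (fun x => 1 / ((q:ℝ) - x 1)) N.domain ∧ y = of N} ∪
   {y : FormalRep | ∃ N : IntegralRep 2, N.domain = {x | ∀ i, x i ∈ Set.Ioo (0:ℝ) 1} ∧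
      EqOn N.integrand (fun x => 1 / ((q:ℝ) - x 0 * x 1)) N.domain ∧ y = of N} ∪
   {y : FormalRep | ∃ N : IntegralRep 2, N.domain = {x | ∀ i, x i ∈ Set.Ioo (0:ℝ) 1} ∧
      EqOn N.integrand (fun x => 1 / (((q:ℝ) - x 0) * ((q:ℝ) - x 1))) N.domain ∧ y = of N} ∪
   {y : FormalRep | ∃ N : IntegralRep 2, N.domain = {x | ∀ i, x i ∈ Set.Ioo (0:ℝ) 1} ∧
      EqOn N.integrand (fun x => 1 / (((q:ℝ) - x 0) * ((q:ℝ) - x 0 * x 1))) N.domain ∧ y = of N} ∪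
   {y : FormalRep | ∃ N : IntegralRep 2, N.domain = {x | ∀ i, x i ∈ Set.Ioo (0:ℝ) 1} ∧
      EqOn N.integrand (fun x => 1 / (((q:ℝ) - x 1) * ((q:ℝ) - x 0 * x 1))) N.domain ∧ y = of N} ∪
   {y : FormalRep | ∃ N : IntegralRep 2, N.domain = {x | ∀ i, x i ∈ Set.Ioo (0:ℝ) 1} ∧
      EqOn N.integrand (fun x => 1 / (((q:ℝ) - x 0) * ((q:ℝ) - x 1) * ((q:ℝ) - x 0 * x 1))) N.domain ∧ y = of N})

/-- **Floor inclusion**: at height `1` the sector generators are (pointwise the same functions as) the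
eight island atoms. [cite: KontsevichZagier2001, §1.1] -/
theorem gens_one_subset_islandGens (q : ℕ) : gens 0 1 1 q ⊆ islandGens q := by
  rintro y ⟨N, a, b, i, j, m, hab, hi, hj, hm, hd, hf, rfl⟩
  obtain ⟨rfl, rfl⟩ : a = 0 ∧ b = 0 := ⟨by omega, by omega⟩
  simp only [islandGens, Set.mem_union, Set.mem_setOf_eq]
  interval_cases i <;> interval_cases j <;> interval_cases m
  · exact Or.inl <| Or.inl <| Or.inl <| Or.inl <| Or.inl <| Or.inl <| Or.inl
      ⟨N, hd, fun x hx => by rw [hf hx]; simp, rfl⟩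
  · exact Or.inl <| Or.inl <| Or.inl <| Or.inl <| Or.inr
      ⟨N, hd, fun x hx => by rw [hf hx]; simp, rfl⟩
  · exact Or.inl <| Or.inl <| Or.inl <| Or.inl <| Or.inl <| Or.inr
      ⟨N, hd, fun x hx => by rw [hf hx]; simp, rfl⟩
  · exact Or.inl <| Or.inr
      ⟨N, hd, fun x hx => by rw [hf hx]; simp, rfl⟩
  · exact Or.inl <| Or.inl <| Or.inl <| Or.inl <| Or.inl <| Or.inl <| Or.inr
      ⟨N, hd, fun x hx => by rw [hf hx]; simp, rfl⟩
  · exact Or.inl <| Or.inl <| Or.inr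
      ⟨N, hd, fun x hx => by rw [hf hx]; simp, rfl⟩
  · exact Or.inl <| Or.inl <| Or.inl <| Or.inr
      ⟨N, hd, fun x hx => by rw [hf hx]; simp, rfl⟩
  · exact Or.inr
      ⟨N, hd, fun x hx => by rw [hf hx]; simp [mul_assoc], rfl⟩

/-- **FLOOR of the ladder (`E = 1`) = the product island of lead c9** — a tree theorem
(`island_mem_relations_of_eval_eq_zero`, 2026-08-17), by monotonicity of the generated subgroup.
[cite: KontsevichZagier2001, §1.2 Conjecture 1] [cite: ViolaZudilin2018, Thm 1] -/
theorem sectorIsland_one : SectorIsland 1 := fun q hq hrig _ hc hv =>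
  island_mem_relations_of_eval_eq_zero q hq hrig
    (AddSubgroup.closure_mono (gens_one_subset_islandGens q) hc) hv

/-- **On-path record (`S → Rung`)**: every rung is a consequence of the summit (Conjecture 1 in
kernel form gives the kernel statement on any subgroup, for any `E`). [cite: KontsevichZagier2001, §1.2 Conjecture 1] -/
theorem sectorIsland_of_statement (h : _root_.KontsevichZagierPeriods) (E : ℕ) : SectorIsland E :=
  fun _ _ _ c _ hv => (kzKernelConjecture_iff_isRational.mpr (KontsevichZagierPeriods_iff.mp h)) c hv

/-- F3: the rung family specialises to its floor. -/
example : SectorIsland 1 := sectorIsland_one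


end Summit.KontsevichZagierPeriods.KontsevichZagierPeriods.Cruxes.NormalFormPrinciple.SectorLadder
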